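/-
Copyright (c) 2026. All rights reserved.
Released under Apache 2.0 license as described in the file LICENSE.
Authors: abc-iut cell, seat abc-iut-w5-d169 (gen 16; row «PL2-LEAF-2», (B★)-proof).
-/
import Literature.AnabelianGeometry.EtaleTheta.SettingModelThetaEigenStatements
import Literature.AnabelianGeometry.EtaleTheta.SettingModelPrimaryDecomposition
import Literature.AnabelianGeometry.EtaleTheta.SettingModelTorusEigenBalanced
import Literature.AnabelianGeometry.EtaleTheta.SettingModelCyclotomicCharacterPrimaryUnbounded
import HarnessLib

/-!
# Torus rigidity in `F̂₂` (conjugacy form): ★ `ThetaEigenRigidityConj p` and ★ `TEigenRigidityConj p`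

Mochizuki, *The étale theta function …* [EtTh] §1, PRIMS p. 12 («`Δ_X` … a profinite free group on 2 generators»;
the cyclotomic action on the theta quotient) [cite: MochizukiEtTh2009, §1 p.12] — the TARGET TYPES
`SettingModel.ThetaEigenRigidityConj p` / `SettingModel.TEigenRigidityConj p` of `SettingModelThetaEigenStatements`
(abc-iut-w5-d169 gen 15, statement-only, DEFINITION FROZEN 2b9ea8f304b6d61c), discharged by assembling THEOREM A
(`SettingModelPrimaryDecomposition.exists_eq_conj_bPow_of_forall_level_balanced`) and (T⇒E)
(`SettingModelTorusEigenBalanced.normL_lev_alpha_eq_zero_of_torusLaw`, fed with (Hχ‴)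
`SettingModelCyclotomicCharacterPrimaryUnbounded.exists_levelChar_chi_pow_ne_one`), BY NAME.

PROOF-ONLY file (no definition, no instance, no notation), abc-iut cell layer L6, seat abc-iut-w5-d169 (gen 16), row
PL2-LEAF-2 of abc-iut-L6-lead — the **(B★)-proof** of programme P-L2, rung (L2-T): Theorem B of the cell's desk text
PL2-SEP-PROOF-v2 (sha16 9791feedc2eba23e) §6, *«Under (Hχ′), every `w ∈ F̂₂` satisfying the torus law lies in `C`:
`w = g b^t g⁻¹` (`g ∈ F̂₂`, `t ∈ Ẑ`). Proof: Lemma 4′ (all open normal `N`) + Theorem A.»*, for OUR model and OUR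
`χ = chi p` (for which (Hχ‴) is PROVED, `SettingModelCyclotomicCharacterPrimaryUnbounded`):

* ★ `thetaEigenRigidityConj : ThetaEigenRigidityConj p` — torus rigidity, conjugacy form;
* ★ `tEigenRigidityConj : TEigenRigidityConj p` — T-eigen rigidity, conjugacy form (the floor of record of rung
  (L2-T); the Kummer conjunct of `IsTEigenConj` is idle).
Statements about OUR semi-synthetic model (`F₂hatT`, `twist`, `chi p`, `powHat`, `affTwist₃`); the cells hextΔ / hΘ
are NOT touched here (no `SettingModelTate*` / `ThetaSettingHext*` import); nothing of [EtTh] / [IUTchII] /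
[IUTchIII] in print is asserted; no side is taken on [IUTchIII] Cor. 3.12; typed ≠ proved ≠ print.
-/

noncomputable section

namespace Literature.AnabelianGeometry.EtaleTheta.SettingModel

/-- **THEOREM B — torus rigidity, conjugacy form: ★ `ThetaEigenRigidityConj p` holds for OUR model.**  Every
`w ∈ F̂₂` whose cyclotomic twists `θ_{χ(σ)}(w)` (`σ ∈ G_{ℚ_p}`) are conjugate to `w^{χ(σ)(1)}` is conjugate to a
`Ẑ`-power of `b`: `w = g b^t g⁻¹`.  Assembly BY NAME of (T⇒E) `normL_lev_alpha_eq_zero_of_torusLaw` (the torus law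
⇒ a-balance at every level, every prime; its input (Hχ‴) for `χ` is `exists_levelChar_chi_pow_ne_one`) and THEOREM A `exists_eq_conj_bPow_of_forall_level_balanced` (level-wise
a-balance ⇒ conjugate into `b^Ẑ`); `bPow = powHat (η b)` (`bPow_eq_powHat`).  The cell's desk text PL2-SEP-PROOF-v2
(sha16 9791feedc2eba23e) §6, KERNEL-CHECKED for the semi-synthetic model (`F₂hatT`, `twist`, `chi p`, `powHat`);
nothing of [EtTh] in print is asserted; no side is taken on [IUTchIII] Cor. 3.12. [cite: MochizukiEtTh2009, §1 p.12] -/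
theorem thetaEigenRigidityConj (p : ℕ) [Fact p.Prime] :
    Literature.AnabelianGeometry.EtaleTheta.SettingModel.ThetaEigenRigidityConj p := by
  intro w hw
  obtain ⟨g, t, h⟩ := exists_eq_conj_bPow_of_forall_level_balanced w
    fun G _ _ _ A B ℓ _ => normL_lev_alpha_eq_zero_of_torusLaw (chi p)
      (fun ℓ' hℓ' M hM => exists_levelChar_chi_pow_ne_one p hℓ' hM) w hw A B ℓ
  exact ⟨g, t, by rw [h, bPow_eq_powHat]⟩

/-- `ThetaEigenRigidityConj` holds for all parameters — `_holds` alias of `thetaEigenRigidityConj` above under the fact's exact name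
(appended 2026-08-28, D-0026 bookkeeping: the proof term is the existing theorem of this file; no statement,
definition or attribute is edited; no new named fact; the ledger's debt table listed the fact
unproved). [cite: MochizukiEtTh2009, §1 p.12] -/
theorem _root_.Literature.AnabelianGeometry.EtaleTheta.SettingModel.ThetaEigenRigidityConj_holds
    (p : ℕ) [Fact p.Prime] :
    Literature.AnabelianGeometry.EtaleTheta.SettingModel.ThetaEigenRigidityConj p :=
  _root_.Literature.AnabelianGeometry.EtaleTheta.SettingModel.thetaEigenRigidityConj p

/-- **★ `TEigenRigidityConj p` — T-EIGEN RIGIDITY (conjugacy form), the floor of record of rung (L2-T):** every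
T-eigen element of `F̂₂` (torus law ∧ Kummer law) is conjugate to a `Ẑ`-power of `b`.  Immediate from
`thetaEigenRigidityConj` (the Kummer conjunct is idle). [cite: MochizukiEtTh2009, §1 p.12] -/
theorem tEigenRigidityConj (p : ℕ) [Fact p.Prime] :
    Literature.AnabelianGeometry.EtaleTheta.SettingModel.TEigenRigidityConj p :=
  fun w hw => thetaEigenRigidityConj p w hw.1

/-- `TEigenRigidityConj` holds for all parameters — `_holds` alias of `tEigenRigidityConj` above under the fact's exact name
(appended 2026-08-28, D-0026 bookkeeping: the proof term is the existing theorem of this file; no statement,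
definition or attribute is edited; no new named fact; the ledger's debt table listed the fact
unproved). [cite: MochizukiEtTh2009, §1 p.12] -/
theorem _root_.Literature.AnabelianGeometry.EtaleTheta.SettingModel.TEigenRigidityConj_holds
    (p : ℕ) [Fact p.Prime] :
    Literature.AnabelianGeometry.EtaleTheta.SettingModel.TEigenRigidityConj p :=
  _root_.Literature.AnabelianGeometry.EtaleTheta.SettingModel.tEigenRigidityConj p

end Literature.AnabelianGeometry.EtaleTheta.SettingModel

end
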